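import Literature.Probability.RandomPlanarGeometry.SquaredWalkPolygons
import Literature.Probability.RandomPlanarGeometry.SAWCount
import Mathlib.Analysis.SpecialFunctions.Pow.Asymptotics
import HarnessLib

/-!
# Proposition 3 of Duminil-Copin–Kozma–Yadin 2014 from Lemma 5:
# `limsup_m Z_m(x) = ∞` for `x > 1/μ`

Topic `Literature/Probability/RandomPlanarGeometry`. This file DISCHARGES the step
"Lemma 5 ⟹ Proposition 3" of H. Duminil-Copin, G. Kozma, A. Yadin, *Supercritical self-avoiding
walks are space-filling*, Ann. IHP Probab. Stat. 50 (2014) 315–326 (arXiv:1110.3074), §2, over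
the tree's objects: the named facts `DKY2014_lem5` ("for `c` sufficiently large and `n` even, the
number `aₙ` of squared walks of length `n` satisfies `aₙ ≥ μⁿ e^{-c√n}`") and `DKY2014_prop3`
("for `x > 1/μ`, `limsup_{m→∞} Z_m(x) = ∞`") of `SupercriticalSAWPolygons.lean`, and the polygon
construction `SquaredWalkPolygon.polygonEdges` of `SquaredWalkPolygons.lean`:

* `pow_four_mul_pow_le_Zbox` — **`Z_m(x) ≥ (#squared walks of length n and span m)⁴ · x^{4n+4}`**
  for `x ≥ 0` (the printed "`Z_m(x) ≥ x^{4n+4} (aₙ/n)⁴`" before the choice of the span: the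
  quadruples of squared walks inject into the `(4n+4)`-edge polygons of `P_m`);
* `succ_le_sq_of_mem_squaredWalksOfSpan` — a squared walk of length `n` and span `m` has
  `n + 1 ≤ (m+1)²` distinct vertices in `[0,m]²`, so the spans of long squared walks are large
  (the printed remark that the maximising `m` need not be known is reflected here: ANY span
  carrying at least the average number `aₙ/(2n+1)²` of walks is used,
  `exists_span_squaredWalkCount_le`);
* `tendsto_pow_mul_exp_neg_sqrt_div` — `ρⁿ e^{-c√n}/(2n+1)² → ∞` for `ρ > 1` (the printed "When `n`
  goes to infinity, the right-hand side goes to infinity", with `ρ = xμ > 1`);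
* **`DKY2014_prop3_of_lem5 : DKY2014_lem5 → DKY2014_prop3`**.

What remains upstream of Proposition 3 on the DAG of Theorem 1
(`Literature.Barriers.CriticalPhenomena.SupercriticalSAW.DKY2014_thm1`) is Lemma 5 itself, whose
printed proof rests on the Hammersley–Welsh bridge bound (2.1) (`DKY2014_eq21`).
-/

noncomputable section

open Filter Topology SimpleGraph Literature.Probability.LatticeModels Literature.Probability.Percolation
open scoped BigOperators

namespace Literature.Probability.RandomPlanarGeometry.SAW

open SquaredWalkPolygon

/-! ### Squared walks of given length and span -/

open Classical in
/-- The squared walks of length `n` and span `m` (self-avoiding walks of `ℤ²` from `(0,0)` to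
`(m,m)` inside `[0,m]²` with `n` steps), as a finset of Mathlib walks; `aₙ = squaredWalkCount n`
sums their number over the spans. [cite: DuminilCopinKozmaYadin2014, §2 (squared walks)] -/
def squaredWalksOfSpan (n m : ℕ) : Finset ((zdGraph 2).Walk (0 : Site 2) (diag m)) :=
  ((zdGraph 2).finsetWalkLength n 0 (diag m)).filter fun p => IsSquaredWalk p

/-- Membership in `squaredWalksOfSpan`. [cite: DuminilCopinKozmaYadin2014, §2 (squared walks)] -/
theorem mem_squaredWalksOfSpan {n m : ℕ} {p : (zdGraph 2).Walk (0 : Site 2) (diag m)} :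
    p ∈ squaredWalksOfSpan n m ↔ p.length = n ∧ IsSquaredWalk p := by
  classical
  rw [squaredWalksOfSpan, Finset.mem_filter, mem_finsetWalkLength_iff]

/-- A squared walk of length `n` and span `m` visits `n+1` distinct sites of `[0,m]²`, so
`n + 1 ≤ (m+1)²`. [cite: DuminilCopinKozmaYadin2014, §2 (squared walks)] -/
theorem succ_le_sq_of_mem_squaredWalksOfSpan {n m : ℕ} {p : (zdGraph 2).Walk (0 : Site 2) (diag m)}
    (hp : p ∈ squaredWalksOfSpan n m) : n + 1 ≤ (m + 1) ^ 2 := by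
  classical
  obtain ⟨hn, hsq⟩ := mem_squaredWalksOfSpan.1 hp
  obtain ⟨hpath, hb⟩ := isSq_of_isSquaredWalk hsq
  have hsub : p.support.toFinset ⊆ Fintype.piFinset fun _ : Fin 2 => Finset.Icc (0 : ℤ) m := by
    intro w hw
    rw [List.mem_toFinset] at hw
    rw [Fintype.mem_piFinset]
    intro i
    rw [Finset.mem_Icc]
    exact hb w hw i
  have hcard := Finset.card_le_card hsub
  rw [List.toFinset_card_of_nodup ((Walk.isPath_def _).1 hpath), Walk.length_support, hn,
    Fintype.card_piFinset_const, Int.card_Icc] at hcard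
  have : (↑m + 1 - 0 : ℤ).toNat = m + 1 := by omega
  rwa [this] at hcard

/-- Pigeonhole over the endpoints: some span `m` carries at least `aₙ/(2n+1)²` of the `aₙ`
squared walks of length `n` (all endpoints lie in the box `{-n,…,n}²` of `(2n+1)²` sites), and
carries at least one of them if `aₙ > 0`. [cite: DuminilCopinKozmaYadin2014, §2 (proof of Proposition 3: "Fix now m to be such that the number of such walks is maximized")] -/
theorem exists_span_squaredWalkCount_le (n : ℕ) : ∃ m : ℕ,
    squaredWalkCount n ≤ (2 * n + 1) ^ 2 * (squaredWalksOfSpan n m).card ∧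
      (0 < squaredWalkCount n → (squaredWalksOfSpan n m).Nonempty) := by
  classical
  -- some endpoint `v` carries at least the average number of squared walks
  set f : Site 2 → ℕ := fun v =>
    (((zdGraph 2).finsetWalkLength n (0 : Site 2) v).filter fun p => IsSquaredWalk p).card with hf
  have hsum : squaredWalkCount n = ∑ v ∈ box 2 n, f v := rfl
  have hbox : (box 2 n).Nonempty := ⟨0, by simp [mem_box]⟩
  obtain ⟨v, hv, hle⟩ : ∃ v ∈ box 2 n, squaredWalkCount n ≤ (box 2 n).card * f v := by
    have h : ∑ _v ∈ box 2 n, squaredWalkCount n ≤ ∑ v ∈ box 2 n, (box 2 n).card * f v := by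
      rw [Finset.sum_const, smul_eq_mul, ← Finset.mul_sum, ← hsum]
    exact Finset.exists_le_of_sum_le hbox h
  rw [card_box] at hle
  by_cases hfv : f v = 0
  · refine ⟨0, ?_, fun hpos => ?_⟩ <;> rw [hfv, mul_zero] at hle <;> omega
  -- a squared walk ending at `v` forces `v = diag m`
  obtain ⟨p, hp⟩ := Finset.card_pos.1 (Nat.pos_of_ne_zero hfv)
  obtain ⟨-, -, m, rfl, -⟩ := (Finset.mem_filter.1 hp)
  exact ⟨m, hle, fun _ => ⟨p, hp⟩⟩

/-! ### The entropy bound `Z_m(x) ≥ (#squared walks)⁴ x^{4n+4}` -/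

/-- The polygon map on quadruples (nested pairs) of walks. [cite: DuminilCopinKozmaYadin2014, §2 (proof of Proposition 3)] -/
def polygonOfQuad (m : ℕ) (q : (zdGraph 2).Walk (0 : Site 2) (diag m) ×
    (zdGraph 2).Walk (0 : Site 2) (diag m) × (zdGraph 2).Walk (0 : Site 2) (diag m) ×
      (zdGraph 2).Walk (0 : Site 2) (diag m)) : Finset (Sym2 (Site 2)) :=
  polygonEdges m q.1 q.2.1 q.2.2.1 q.2.2.2

/-- **`Z_m(x) ≥ (#squared walks of length n and span m)⁴ · x^{4n+4}`** for `x ≥ 0`: distinct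
quadruples of squared walks give distinct `(4n+4)`-edge polygons of `P_m`
(`polygonEdges_mem_facePolygons`, `card_polygonEdges`, `polygonEdges_injective`).
[cite: DuminilCopinKozmaYadin2014, §2 (proof of Proposition 3: "Z_m(x) ≥ x^{4n+4}(aₙ/n)⁴")] -/
theorem pow_four_mul_pow_le_Zbox (n m : ℕ) {x : ℝ} (hx : 0 ≤ x) :
    ((squaredWalksOfSpan n m).card : ℝ) ^ 4 * x ^ (4 * n + 4) ≤ Zbox m x := by
  classical
  set S := squaredWalksOfSpan n m with hS
  set D := S ×ˢ (S ×ˢ (S ×ˢ S)) with hD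
  have hmemS : ∀ {p}, p ∈ S → IsSq m p ∧ p.length = n := fun hp =>
    ⟨isSq_of_isSquaredWalk (mem_squaredWalksOfSpan.1 hp).2, (mem_squaredWalksOfSpan.1 hp).1⟩
  have hmemD : ∀ {q}, q ∈ D → (IsSq m q.1 ∧ q.1.length = n) ∧ (IsSq m q.2.1 ∧ q.2.1.length = n) ∧
      (IsSq m q.2.2.1 ∧ q.2.2.1.length = n) ∧ (IsSq m q.2.2.2 ∧ q.2.2.2.length = n) := by
    intro q hq
    simp only [hD, Finset.mem_product] at hq
    exact ⟨hmemS hq.1, hmemS hq.2.1, hmemS hq.2.2.1, hmemS hq.2.2.2⟩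
  -- the image of `D` lies in `P_m`, consists of `(4n+4)`-edge polygons, and has `#S⁴` elements
  have hsub : D.image (polygonOfQuad m) ⊆ facePolygons m := by
    intro E hE
    obtain ⟨q, hq, rfl⟩ := Finset.mem_image.1 hE
    obtain ⟨⟨h₁, -⟩, ⟨h₂, -⟩, ⟨h₃, -⟩, ⟨h₄, -⟩⟩ := hmemD hq
    exact polygonEdges_mem_facePolygons h₁ h₂ h₃ h₄
  have hcardE : ∀ E ∈ D.image (polygonOfQuad m), E.card = 4 * n + 4 := by
    intro E hE
    obtain ⟨q, hq, rfl⟩ := Finset.mem_image.1 hE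
    obtain ⟨⟨h₁, l₁⟩, ⟨h₂, l₂⟩, ⟨h₃, l₃⟩, ⟨h₄, l₄⟩⟩ := hmemD hq
    exact card_polygonEdges h₁ h₂ h₃ h₄ l₁ l₂ l₃ l₄
  have hinj : Set.InjOn (polygonOfQuad m) D := by
    intro q hq q' hq' h
    obtain ⟨⟨h₁, -⟩, ⟨h₂, -⟩, ⟨h₃, -⟩, ⟨h₄, -⟩⟩ := hmemD (Finset.mem_coe.1 hq)
    obtain ⟨⟨h₁', -⟩, ⟨h₂', -⟩, ⟨h₃', -⟩, ⟨h₄', -⟩⟩ := hmemD (Finset.mem_coe.1 hq')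
    obtain ⟨e₁, e₂, e₃, e₄⟩ := polygonEdges_injective h₁ h₂ h₃ h₄ h₁' h₂' h₃' h₄' h
    obtain ⟨a, b, c, d⟩ := q
    obtain ⟨a', b', c', d'⟩ := q'
    simp only at e₁ e₂ e₃ e₄
    subst e₁ e₂ e₃ e₄
    rfl
  have hcardD : (D.image (polygonOfQuad m)).card = S.card ^ 4 := by
    rw [Finset.card_image_of_injOn hinj, hD, Finset.card_product, Finset.card_product,
      Finset.card_product]
    ring
  calc (S.card : ℝ) ^ 4 * x ^ (4 * n + 4)
      = ∑ E ∈ D.image (polygonOfQuad m), x ^ E.card := by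
        rw [Finset.sum_congr rfl fun E hE => by rw [hcardE E hE], Finset.sum_const, hcardD,
          nsmul_eq_mul, Nat.cast_pow]
    _ ≤ Zbox m x :=
        Finset.sum_le_sum_of_subset_of_nonneg hsub fun _ _ _ => pow_nonneg hx _

/-! ### Growth: `ρⁿ e^{-c√n}/(2n+1)² → ∞` for `ρ > 1` -/

/-- For `ρ > 1` and any `c`, `ρⁿ e^{-c√n} / (2n+1)² → ∞`: the exponential beats the stretched
exponential and the polynomial. [cite: DuminilCopinKozmaYadin2014, §2 (proof of Proposition 3: "When n goes to infinity, the right-hand side goes to infinity")] -/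
theorem tendsto_pow_mul_exp_neg_sqrt_div {ρ : ℝ} (hρ : 1 < ρ) (c : ℝ) :
    Tendsto (fun n : ℕ => ρ ^ n * Real.exp (-(c * Real.sqrt n)) / (2 * n + 1) ^ 2)
      atTop atTop := by
  set β := Real.log ρ with hβ
  have hβ0 : 0 < β := Real.log_pos hρ
  -- the comparison function `e^{βn/2}/(9 n²) = (β²/36) · (e^y / y²)` at `y = βn/2`
  have hL : Tendsto (fun n : ℕ => β ^ 2 / 36 * (Real.exp (β / 2 * n) / (β / 2 * n) ^ 2))
      atTop atTop := by
    refine Tendsto.const_mul_atTop (by positivity) ?_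
    exact (Real.tendsto_exp_div_pow_atTop 2).comp
      (tendsto_natCast_atTop_atTop.const_mul_atTop (by positivity))
  refine tendsto_atTop_mono' atTop ?_ hL
  -- eventually `c√n ≤ βn/2` and `(2n+1)² ≤ 9n²`
  have h1 : ∀ᶠ n : ℕ in atTop, c * Real.sqrt n ≤ β / 2 * n := by
    refine (eventually_ge_atTop (Nat.ceil ((2 * |c| / β) ^ 2))).mono fun n hn => ?_
    have hn' : (2 * |c| / β) ^ 2 ≤ n := (Nat.ceil_le).1 hn
    have hsq : 2 * |c| / β ≤ Real.sqrt n := by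
      rw [Real.le_sqrt (by positivity) (by positivity)]
      exact hn'
    have hcs : c * Real.sqrt n ≤ |c| * Real.sqrt n :=
      mul_le_mul_of_nonneg_right (le_abs_self c) (Real.sqrt_nonneg _)
    have key : |c| * Real.sqrt n ≤ β / 2 * n := by
      have h2 : |c| ≤ β / 2 * Real.sqrt n := by
        rw [div_le_iff₀ hβ0] at hsq
        linarith
      calc |c| * Real.sqrt n ≤ β / 2 * Real.sqrt n * Real.sqrt n :=
            mul_le_mul_of_nonneg_right h2 (Real.sqrt_nonneg _)
        _ = β / 2 * n := by rw [mul_assoc, Real.mul_self_sqrt (Nat.cast_nonneg n)]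
    exact hcs.trans key
  filter_upwards [h1, eventually_ge_atTop 1] with n hn hn1
  have hn1' : (1 : ℝ) ≤ n := by exact_mod_cast hn1
  have hρn : ρ ^ n = Real.exp (β * n) := by
    rw [hβ, mul_comm, Real.exp_nat_mul, Real.exp_log (zero_lt_one.trans hρ)]
  have hnum : Real.exp (β / 2 * n) ≤ ρ ^ n * Real.exp (-(c * Real.sqrt n)) := by
    rw [hρn, ← Real.exp_add, Real.exp_le_exp]
    linarith
  have hden : ((2 : ℝ) * n + 1) ^ 2 ≤ 9 * (n : ℝ) ^ 2 := by nlinarith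
  have hden0 : (0 : ℝ) < (2 * n + 1) ^ 2 := by positivity
  calc β ^ 2 / 36 * (Real.exp (β / 2 * n) / (β / 2 * n) ^ 2)
      = Real.exp (β / 2 * n) / (9 * (n : ℝ) ^ 2) := by
        field_simp
        ring
    _ ≤ Real.exp (β / 2 * n) / (2 * n + 1) ^ 2 :=
        div_le_div_of_nonneg_left (Real.exp_nonneg _) hden0 hden
    _ ≤ ρ ^ n * Real.exp (-(c * Real.sqrt n)) / (2 * n + 1) ^ 2 :=
        div_le_div_of_nonneg_right hnum hden0.le

/-! ### Proposition 3 from Lemma 5 -/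

/-- **Lemma 5 implies Proposition 3** (Duminil-Copin–Kozma–Yadin 2014, §2): if
`aₙ ≥ μⁿ e^{-c√n}` for even `n`, then for every `x > 1/μ` and every `M`, `Z_m(x) ≥ M` for
infinitely many `m`. Proof as printed: for even `n`, a span `m = m(n)` carrying
`≥ aₙ/(2n+1)²` squared walks of length `n` gives, by the four-walk polygon construction,
`Z_m(x) ≥ (x^{n+1} aₙ/(2n+1)²)⁴ ≥ (x (xμ)ⁿ e^{-c√n}/(2n+1)²)⁴ → ∞`; and `m(n) → ∞` because a
squared walk of length `n` and span `m` has `n+1 ≤ (m+1)²`.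
[cite: DuminilCopinKozmaYadin2014, Proposition 3] -/
theorem DKY2014_prop3_of_lem5 (h5 : DKY2014_lem5) : DKY2014_prop3 := by
  obtain ⟨c, hc⟩ := h5
  intro x hx M
  rw [Filter.frequently_atTop]
  intro N
  -- constants: `μ > 0`, `x > 0`, `ρ = xμ > 1`
  have hμ : 0 < connectiveConstant := by
    rw [← Zd.connectiveConstant_two]
    exact Zd.connectiveConstant_pos 2
  have hxc : 0 < criticalFugacity := inv_pos.2 hμ
  have hx0 : 0 < x := hxc.trans hx
  have hρ : 1 < x * connectiveConstant := by
    have := mul_lt_mul_of_pos_right hx hμ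
    rwa [criticalFugacity, inv_mul_cancel₀ hμ.ne'] at this
  -- the lower bound `T n = x · (xμ)ⁿ e^{-c√n}/(2n+1)²` tends to infinity
  set T : ℕ → ℝ := fun n =>
    x * ((x * connectiveConstant) ^ n * Real.exp (-(c * Real.sqrt n)) / (2 * n + 1) ^ 2) with hT
  have hTlim : Tendsto T atTop atTop :=
    Tendsto.const_mul_atTop hx0 (tendsto_pow_mul_exp_neg_sqrt_div hρ c)
  obtain ⟨n₀, hn₀⟩ := eventually_atTop.1 (hTlim.eventually_ge_atTop (max M 1))
  -- an even `n` beyond `n₀` and `(N+1)²`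
  set n : ℕ := 2 * max n₀ ((N + 1) ^ 2) with hn
  have hn_ge₀ : n₀ ≤ n := by omega
  have hn_geN : (N + 1) ^ 2 ≤ n := by omega
  have hn_even : Even n := ⟨max n₀ ((N + 1) ^ 2), by omega⟩
  have hTn : max M 1 ≤ T n := hn₀ n hn_ge₀
  -- Lemma 5 at `n`, and a span `m` carrying many squared walks of length `n`
  have h5n := hc n hn_even
  have hapos : (0 : ℝ) < squaredWalkCount n := lt_of_lt_of_le (by positivity) h5n
  obtain ⟨m, hm, hne⟩ := exists_span_squaredWalkCount_le n
  have hne' := hne (by exact_mod_cast hapos)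
  refine ⟨m, ?_, ?_⟩
  · -- the span is large: `(N+1)² ≤ n < n + 1 ≤ (m+1)²`
    obtain ⟨p, hp⟩ := hne'
    have := succ_le_sq_of_mem_squaredWalksOfSpan hp
    have hlt : (N + 1) ^ 2 < (m + 1) ^ 2 := by omega
    have := (Nat.pow_lt_pow_iff_left two_ne_zero).1 hlt
    omega
  · -- `M ≤ T n ≤ (T n)⁴ ≤ (#S)⁴ x^{4n+4} ≤ Z_m(x)`
    have hS : (squaredWalkCount n : ℝ) ≤ (2 * n + 1) ^ 2 * (squaredWalksOfSpan n m).card := by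
      exact_mod_cast hm
    have hden0 : (0 : ℝ) < (2 * n + 1) ^ 2 := by positivity
    have hTle : T n ≤ x ^ (n + 1) * (squaredWalksOfSpan n m).card := by
      have h1 : connectiveConstant ^ n * Real.exp (-(c * Real.sqrt n)) / (2 * n + 1) ^ 2 ≤
          (squaredWalksOfSpan n m).card := by
        rw [div_le_iff₀ hden0]
        linarith
      calc T n = x ^ (n + 1) *
            (connectiveConstant ^ n * Real.exp (-(c * Real.sqrt n)) / (2 * n + 1) ^ 2) := by
            rw [hT]; ring
        _ ≤ x ^ (n + 1) * (squaredWalksOfSpan n m).card :=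
            mul_le_mul_of_nonneg_left h1 (pow_nonneg hx0.le _)
    have hT1 : 1 ≤ T n := (le_max_right _ _).trans hTn
    calc M ≤ T n := (le_max_left _ _).trans hTn
      _ ≤ T n ^ 4 := le_self_pow₀ hT1 (by norm_num)
      _ ≤ (x ^ (n + 1) * (squaredWalksOfSpan n m).card) ^ 4 :=
          pow_le_pow_left₀ (zero_le_one.trans hT1) hTle 4
      _ = ((squaredWalksOfSpan n m).card : ℝ) ^ 4 * x ^ (4 * n + 4) := by ring
      _ ≤ Zbox m x := pow_four_mul_pow_le_Zbox n m hx0.le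

end Literature.Probability.RandomPlanarGeometry.SAW
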